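import Literature.NumberTheory.NumberFields.QuadraticNonNormUnitDyadicIdeal
import HarnessLib

/-!
# Unit squares and quadratic norm residues at a dyadic prime `𝔭` with `e(𝔭|2) = 4`, `f(𝔭|2) = 1`
# (the `π`-order of `a² − c²` for `𝔭`-units `a, c` lies in `{2, 4, 6} ∪ [9, ∞)` — never `8`; a unit `ε` with `π⁸ ‖ ε − 1` is not a norm
# from `F(√(πμ))`): the dyadic obstruction for the THIRD cyclotomic layer `K₂(√(2+θ))/K₂`, `θ⁴ − 4θ² + 2 = 0`

Topic `NumberTheory/NumberFields` (namespace = path).  THEOREM-ONLY file (no definition, no named fact, no instance, no `sorry`), written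
by the prover seat `bsd-line-att-p3` g44 (cell `bsd-f1-sign2`, WIDTH-5 attach on route `AlignedTransportAtTwo`, crux C2
stmt-BirchSwinnertonDyer-22298; `--supports`, closes nothing).  Sequel of `DyadicUnitSquaresRamifiedPrime.lean` (cell `bsd-2adic`, k4-w1 GEN 11: the
case `e = 2`, `2 = π²w`, «`π⁴ ‖ ε − 1 ⟹ ε ≠ (a² − πμb²)/c²`», which decides non-norm units for the SECOND layer `K₁(√(2+√2))/K₁` at a dyadic
prime of `K₁ = K(√2)`) and of `DyadicNonNormAtPrimeIdeal.lean` / `QuadraticNonNormUnitDyadicIdeal.lean` (att-p3 g38: the same at a prime IDEAL,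
principal or not, and in the currency `E_K ∋ u ∉ N_G(Lˣ)` of Chevalley's ambiguous class number formula).  The THIRD layer
`K₃ = K₂(√(2+θ))` over `K₂ = K(θ)`, `θ⁴ − 4θ² + 2 = 0` (`K` of odd degree, `2` unramified in `K`), is decided at a dyadic prime of `K₂` above a
degree-one prime of `K`, where `e = 4`, `f = 1`, `2 = θ⁴·(2θ² − 1)⁻¹·…` and `2 + θ` has `𝔭`-order `1`; this file is the `e = 4` companion.

Purely ring-theoretic statements.  `R` is an integral domain with well-founded divisibility (e.g. the integers of a number field, or the
localisation of a Dedekind domain at a prime), `π ∈ R` a PRIME element with `2 = π⁴·w`, `π ∤ w` («`e = 4`») and `R/(π) = {0, 1}` («`f = 1`»;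
hypothesis `∀ t, π ∣ t ∨ π ∣ t − 1`).  Everything below is the elementary `𝓞/𝔭⁹`-half (`𝔭⁹ = 4𝔭 = 𝔭^{2e+1}`) of the dyadic Hilbert-symbol
calculus (O'Meara §63; the model case is `ℤ₂[ζ₁₆ + ζ₁₆⁻¹]`), proved without completions and without local class field theory:

* §1 `exists_eq_pow_mul_not_dvd_or_pow_dvd` — every `b` is `πⁱ·b'` with `π ∤ b'` for some `i < n`, or `πⁿ ∣ b` (residue field `𝔽₂`).
* §1 ★ `pow_nine_dvd_sq_sub_sq_or_eq_pow_mul` — for `π`-units `a, c`: `π⁹ ∣ a² − c²`, or `a² − c² = π^{2j}·ν` with `π ∤ ν` and `j ∈ {1,2,3}`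
  (`a = 1 + πt`, `c = 1 + πu`, `a² − c² = π²(t − u)(t − u + π³w(1 + πu))`: the `π`-order is `2 + 2·ord(t − u)` when `ord(t − u) ≤ 2`, and
  `≥ 9` when `π³ ∣ t − u`, because then `x₃(x₃ + w + πwu) ≡ x₃(x₃ + 1) ≡ 0`).  This is «`U² ⊂ {u : ord(u − 1) ∈ {2,4,6} ∪ [9,∞)}`», the
  `e = 4`, `f = 1` instance of O'Meara's 63:1 / 63:5 (the unit `1 + 4π·unit⁻¹…` of quadratic defect `4𝔭⁰ = 𝔭⁸` generates the UNRAMIFIED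
  quadratic extension and is the only square class of defect exactly `𝔭^{2e}`).
* §2 ★★ `not_exists_sq_sub_mul_sq_of_pow_eight_dvd` — if `π⁸ ∣ ε − 1` and `π⁹ ∤ ε − 1` then there are no `a, b, c ∈ R`, `c ≠ 0`, with
  `a² − πμ·b² = c²ε` (`π ∤ μ`): descent on the power of `π` in `c` (if `π ∣ c` then `π ∣ a`, `π ∣ b` and `π²` cancels), then with `π ∤ c`:
  `c²(ε − 1) = (a² − c²) − πμb²` where `a² − c²` has `π`-order in `{2,4,6} ∪ [9,∞)` and `πμb²` has ODD order `2·ord(b) + 1` (or `≥ 9`) — the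
  difference never has order exactly `8`.  («`(ε, πμ)_𝔭 = −1` for `ε ≡ 1 + π⁸ (mod π⁹)`»: `ε` lies in the square class of the unit of defect
  `𝔭^{2e}`, whose square root generates the unramified quadratic extension, and `πμ` has odd order — O'Meara 63:10 / 63:11a.)
  `not_exists_sq_sub_mul_sq_fractionRing_of_pow_eight_dvd` — the same with `x, y` in the fraction field: `x² − πμ·y² ≠ ε`.
* §3 at a prime IDEAL `𝔭` of a Dedekind domain (principal or not; localisation at `𝔭`, tree `exists_prime_uniformizer_localizationAtPrime`):
  `not_exists_sq_sub_mul_sq_of_sub_one_mem_pow_eight` / `forall_sq_sub_mul_sq_ne_of_sub_one_mem_pow_eight` (`R/𝔭 = 𝔽₂`, `2 ∈ 𝔭⁴ ∖ 𝔭⁵`,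
  `θ ∈ 𝔭 ∖ 𝔭²`, `ε − 1 ∈ 𝔭⁸ ∖ 𝔭⁹` ⟹ `x² − θy² ≠ ε` in the fraction field: `ε ∉ N(K(√θ)ˣ)`).
* §4 in the currency of Chevalley's formula (number fields `K ⊂ L = K(s)`, `s² = m`, `s ∉ K`, `[L:K] = 2`):
  ★★ `AmbiguousClass.unitsIncl_unitsMap_not_mem_map_norm_of_sub_one_mem_pow_eight` — `v − 1 ∈ 𝔭⁸ ∖ 𝔭⁹` at a prime `𝔭` of `𝓞 K` with residue
  field `𝔽₂`, `2 ∈ 𝔭⁴ ∖ 𝔭⁵`, `m ∈ 𝔭 ∖ 𝔭²` ⟹ `j(v) ∉ N_G(Lˣ)`.  For the cyclotomic layer `K₂(√(2+θ))/K₂` take `m = 2 + θ`.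

HONEST SCOPE: elementary local algebra (O'Meara §63) transported by localisation; only the «non-norm» direction; nothing specific to any
summit; no field, unit or certificate is asserted; BSD is not advanced by this file.

## References

* O. T. O'Meara, *Introduction to Quadratic Forms* (1963), §63A (63:1, 63:1a, 63:2–63:5: squares of dyadic units, the quadratic defect,
  the unit of defect `4𝔬`), §63B (63:10, 63:11a: norms from `F(√m)`, the symbol `(Δ, π) = −1`). [Omeara1963]
* J.-P. Serre, *A Course in Arithmetic* (1973), Ch. II §3.3, Ch. III §1.2 (the model case `ℚ₂`). [Serre1973CourseArithmetic]
* J. Neukirch, *Algebraic Number Theory* (1999), Ch. I §11 (localisation at a prime of a Dedekind domain is a DVR), Ch. V §3 (Hilbert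
  symbols at dyadic places). [NeukirchANT1999]
* L. C. Washington, *Introduction to Cyclotomic Fields*, 2nd ed. (1997), §13.1 (`ℚ_2 = ℚ(ζ₁₆)⁺`, `ℚ_3 = ℚ(ζ₃₂)⁺`), Lemma 13.3 (proof:
  the prime above `2` is totally ramified in `ℚ_n`). [Washington1997]
-/

namespace Literature.NumberTheory.NumberFields

variable {R : Type*} [CommRing R]

/-! ## §1 Residue field `𝔽₂`: `π`-adic decomposition of elements and the square classes of units modulo `π⁹` (`e = 4`) -/

section Residue

variable {π w : R}

/-- If `R/(π) = {0,1}` and `π ∤ a` then `π ∣ a − 1`. [cite: Omeara1963, §63A (residue field of a dyadic prime of degree one)] -/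
private theorem dvd_sub_one_of_not_dvd₈ (hres : ∀ t : R, π ∣ t ∨ π ∣ t - 1) {a : R} (ha : ¬ π ∣ a) : π ∣ a - 1 :=
  (hres a).resolve_left ha

/-- If `π` is not a unit and `π ∣ x − 1` then `π ∤ x`. [cite: Omeara1963, §63A (residue field of a dyadic prime)] -/
private theorem not_dvd_of_dvd_sub_one₈ (hπ : Prime π) {x : R} (h : π ∣ x - 1) : ¬ π ∣ x := by
  rintro h'
  obtain ⟨s, hs⟩ := h
  obtain ⟨s', hs'⟩ := h'
  exact hπ.not_unit (IsUnit.of_mul_eq_one (s' - s) (by linear_combination hs - hs'))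

/-- **`π`-adic decomposition below a given order** (residue field `𝔽₂`, `π` prime): for every `b ∈ R` and `n`, either `b = πⁱ·b'` with
`π ∤ b'` for some `i < n`, or `πⁿ ∣ b`. [cite: Omeara1963, §63A (the order of an element at a discrete spot)] -/
theorem exists_eq_pow_mul_not_dvd_or_pow_dvd (hπ : Prime π) (hres : ∀ t : R, π ∣ t ∨ π ∣ t - 1) (b : R) (n : ℕ) :
    (∃ i : ℕ, ∃ b' : R, i < n ∧ b = π ^ i * b' ∧ ¬ π ∣ b') ∨ π ^ n ∣ b := by
  induction n with
  | zero => exact Or.inr (by rw [pow_zero]; exact one_dvd b)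
  | succ n ih =>
    rcases ih with ⟨i, b', hi, hb, hb'⟩ | ⟨b', hb⟩
    · exact Or.inl ⟨i, b', Nat.lt_succ_of_lt hi, hb, hb'⟩
    · rcases hres b' with ⟨b'', rfl⟩ | h1
      · exact Or.inr ⟨b'', by rw [hb]; ring⟩
      · exact Or.inl ⟨n, b', Nat.lt_succ_self n, hb, not_dvd_of_dvd_sub_one₈ hπ h1⟩

/-- ★ **The `π`-order of `a² − c²` for two `π`-units `a, c` when `2 = π⁴w`, `π ∤ w`, `R/(π) = {0,1}`**: `π⁹ ∣ a² − c²`, or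
`a² − c² = π^{2j}·ν` with `π ∤ ν` for some `j ∈ {1, 2, 3}`.  (`a = 1 + πt`, `c = 1 + πu`, `a + c = π(t + u + π³w)` since `2 = π⁴w`, so
`a² − c² = π²·x·(x + π³w(1 + πu))` with `x = t − u`; if `ord x = i ≤ 2` the order is `2 + 2i ∈ {2,4,6}`; if `π³ ∣ x`, `x = π³x₃`, the cofactor
`x₃(x₃ + w + πwu) ≡ x₃(x₃ + 1) ≡ 0 (mod π)` and the order is `≥ 9`.)  With `c = 1`: the unit squares have `ord(a² − 1) ∈ {2,4,6} ∪ [9, ∞)`,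
`e = 4`, `f = 1`. [cite: Omeara1963, §63A (63:1, 63:1a, 63:5: squares of units modulo `4𝔭`, the quadratic defect)]
[cite: Serre1973CourseArithmetic, Ch. II §3.3 (the model case `ℤ₂`)] -/
theorem pow_nine_dvd_sq_sub_sq_or_eq_pow_mul (hπ : Prime π) (h2 : (2 : R) = π ^ 4 * w) (hw : ¬ π ∣ w)
    (hres : ∀ t : R, π ∣ t ∨ π ∣ t - 1) {a c : R} (ha : ¬ π ∣ a) (hc : ¬ π ∣ c) :
    π ^ 9 ∣ a ^ 2 - c ^ 2 ∨
      ∃ j : ℕ, ∃ ν : R, 1 ≤ j ∧ j ≤ 3 ∧ a ^ 2 - c ^ 2 = π ^ (2 * j) * ν ∧ ¬ π ∣ ν := by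
  obtain ⟨t, ht⟩ := dvd_sub_one_of_not_dvd₈ hres ha
  obtain ⟨u, hu⟩ := dvd_sub_one_of_not_dvd₈ hres hc
  obtain ⟨v, hv⟩ := dvd_sub_one_of_not_dvd₈ hres hw
  have ha' : a = 1 + π * t := by linear_combination ht
  have hc' : c = 1 + π * u := by linear_combination hu
  -- `a² − c² = π² x (x + π³ w (1 + π u))`, `x = t − u`
  set x : R := t - u with hx
  have hD : a ^ 2 - c ^ 2 = π ^ 2 * (x * (x + π ^ 3 * w * (1 + π * u))) := by
    rw [ha', hc', hx]; linear_combination ((t - u) * (π + π ^ 2 * u)) * h2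
  -- `π ∤ y + e` whenever `π ∤ y`, `π ∣ e`
  have hadd : ∀ {y e : R}, π ∣ e → ¬ π ∣ y → ¬ π ∣ y + e := by
    intro y e he hy h
    apply hy
    have h' : π ∣ (y + e) - e := dvd_sub h he
    rwa [add_sub_cancel_right] at h'
  have hmul : ∀ {y z : R}, ¬ π ∣ y → ¬ π ∣ z → ¬ π ∣ y * z := fun hy hz h =>
    (hπ.dvd_or_dvd h).elim hy hz
  rcases exists_eq_pow_mul_not_dvd_or_pow_dvd hπ hres x 3 with ⟨i, x', hi, hxi, hx'⟩ | ⟨x₃, hx₃⟩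
  · right
    interval_cases i
    · -- `ord x = 0`: order `2`
      refine ⟨1, x' * (x' + π ^ 3 * w * (1 + π * u)), le_rfl, by norm_num, ?_, hmul hx' ?_⟩
      · rw [hD, hxi]; ring
      · exact hadd (Dvd.intro (π ^ 2 * w * (1 + π * u)) (by ring)) hx'
    · -- `ord x = 1`: order `4`
      refine ⟨2, x' * (x' + π ^ 2 * w * (1 + π * u)), by norm_num, by norm_num, ?_, hmul hx' ?_⟩
      · rw [hD, hxi]; ring
      · exact hadd (Dvd.intro (π * w * (1 + π * u)) (by ring)) hx'
    · -- `ord x = 2`: order `6`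
      refine ⟨3, x' * (x' + π ^ 1 * w * (1 + π * u)), by norm_num, le_rfl, ?_, hmul hx' ?_⟩
      · rw [hD, hxi]; ring
      · exact hadd (Dvd.intro (w * (1 + π * u)) (by ring)) hx'
  · -- `π³ ∣ x`: order `≥ 9`
    left
    have hD' : a ^ 2 - c ^ 2 = π ^ 8 * (x₃ * (x₃ + w + π * w * u)) := by rw [hD, hx₃]; ring
    rcases hres x₃ with ⟨x₄, rfl⟩ | ⟨x₄, hx₄⟩
    · exact ⟨x₄ * (π * x₄ + w + π * w * u), by rw [hD']; ring⟩
    · -- `x₃ ≡ 1`, `w ≡ 1`: `x₃ + w + π w u ≡ 2 ≡ 0`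
      refine ⟨x₃ * (x₄ + v + π ^ 3 * w + w * u), ?_⟩
      rw [hD']
      linear_combination (π ^ 8 * x₃) * hx₄ + (π ^ 8 * x₃) * hv + (π ^ 8 * x₃) * h2

end Residue

/-! ## §2 `π⁸ ‖ ε − 1` is not `a² − πμ·b²` up to squares -/

section Descent

variable [IsDomain R] [WfDvdMonoid R] {π w μ ε : R}

/-- ★★ **A unit `ε` with `π⁸ ‖ ε − 1` is not `a² − πμ·b²` up to squares: no `a, b, c ∈ R`, `c ≠ 0`, with `a² − πμb² = c²ε`**
(`π` prime, `2 = π⁴w`, `π ∤ w`, `R/(π) = {0,1}`, `π ∤ μ`).  Descent on the power of `π` in `c`; then for `π ∤ c`: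
`c²(ε − 1) = (a² − c²) − πμb²` has `π`-order `= min(ord(a² − c²), 1 + 2·ord b)` — an element of `{2,4,6} ∪ [9,∞)` against an odd number
(or both `≥ 9`) — never exactly `8`.  In Hilbert-symbol language: `(ε, πμ)_𝔭 = −1` for `ε ≡ 1 + π⁸ (mod π⁹)` at a dyadic prime with `e = 4`,
`f = 1`; only this elementary direction is proved, without completions. [cite: Omeara1963, §63B (63:10, 63:11a) and §63A (63:1, 63:5)]
[cite: NeukirchANT1999, Ch. V §3] -/
theorem not_exists_sq_sub_mul_sq_of_pow_eight_dvd (hπ : Prime π) (h2 : (2 : R) = π ^ 4 * w) (hw : ¬ π ∣ w)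
    (hres : ∀ t : R, π ∣ t ∨ π ∣ t - 1) (hμ : ¬ π ∣ μ) (h8 : π ^ 8 ∣ ε - 1) (h9 : ¬ π ^ 9 ∣ ε - 1) :
    ¬ ∃ a b c : R, c ≠ 0 ∧ a ^ 2 - π * μ * b ^ 2 = c ^ 2 * ε := by
  rintro ⟨a, b, c, hc, h⟩
  have hπ0 : π ≠ 0 := hπ.ne_zero
  -- `π ∤ ε`
  have hε : ¬ π ∣ ε := by
    intro hε
    have h1 : π ∣ ε - 1 := (dvd_pow_self π (by norm_num)).trans h8
    have h1' : π ∣ (1 : R) := by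
      have := dvd_sub hε h1
      rwa [sub_sub_cancel] at this
    exact hπ.not_unit (isUnit_of_dvd_one h1')
  -- `π ∣ μ y² ⟹ π ∣ y`
  have hμb : ∀ {y : R}, π ∣ μ * y ^ 2 → π ∣ y := by
    intro y h3
    rcases hπ.dvd_or_dvd h3 with h6 | h6
    · exact absurd h6 hμ
    · exact hπ.dvd_of_dvd_pow h6
  -- cancelling a power of `π`: `π^{m+1} ∣ π^m z ⟹ π ∣ z`
  have hcancel : ∀ {m : ℕ} {z : R}, π ^ (m + 1) ∣ π ^ m * z → π ∣ z := by
    intro m z h3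
    rw [pow_succ] at h3
    exact (mul_dvd_mul_iff_left (pow_ne_zero m hπ0)).mp h3
  obtain ⟨k, c', hc', rfl⟩ := WfDvdMonoid.max_power_factor' hc hπ.not_unit
  induction k generalizing a b with
  | zero =>
    rw [pow_zero, one_mul] at h
    -- `π ∤ a`
    have ha : ¬ π ∣ a := by
      intro hpa
      have h1 : π ∣ c' ^ 2 * ε := by
        rw [← h]
        exact dvd_sub (dvd_pow hpa two_ne_zero) (Dvd.intro (μ * b ^ 2) (by ring))
      rcases hπ.dvd_or_dvd h1 with h3 | h3
      · exact hc' (hπ.dvd_of_dvd_pow h3)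
      · exact hε h3
    -- `Δ = c'²(ε − 1) = (a² − c'²) − πμ b²`, `π⁸ ∣ Δ`, `π⁹ ∤ Δ`
    have hΔ : c' ^ 2 * (ε - 1) = (a ^ 2 - c' ^ 2) - π * μ * b ^ 2 := by linear_combination -h
    have h8Δ : π ^ 8 ∣ (a ^ 2 - c' ^ 2) - π * μ * b ^ 2 := by rw [← hΔ]; exact h8.mul_left _
    have h9Δ : ¬ π ^ 9 ∣ (a ^ 2 - c' ^ 2) - π * μ * b ^ 2 := by
      rw [← hΔ]
      exact fun h9' => h9 (hπ.pow_dvd_of_dvd_mul_left 9 hc' (hπ.pow_dvd_of_dvd_mul_left 9 hc' (by rwa [sq, mul_assoc] at h9')))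
    -- from `πⁿ ∣ D − E`: `πⁿ ∣ E ⟹ πⁿ ∣ D` and `πⁿ ∣ D ⟹ πⁿ ∣ E`
    have hDE : ∀ {n : ℕ} {D E : R}, π ^ n ∣ D - E → π ^ n ∣ E → π ^ n ∣ D := by
      intro n D E h1 h3
      have := dvd_add h1 h3
      rwa [sub_add_cancel] at this
    have hED : ∀ {n : ℕ} {D E : R}, π ^ n ∣ D - E → π ^ n ∣ D → π ^ n ∣ E := by
      intro n D E h1 h3
      have := dvd_sub h3 h1
      rwa [sub_sub_cancel] at this
    -- the `π`-order of `E = πμb²` is odd (or `≥ 9`)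
    rcases exists_eq_pow_mul_not_dvd_or_pow_dvd hπ hres b 4 with ⟨i, b', hi, hbi, hb'⟩ | ⟨b'', hb''⟩
    · -- `b = πⁱ b'`, `π ∤ b'`, `i ≤ 3`: `E = π^{2i+1} (μ b'²)`
      have hE : π * μ * b ^ 2 = π ^ (2 * i + 1) * (μ * b' ^ 2) := by rw [hbi]; ring
      have hE' : ¬ π ∣ μ * b' ^ 2 := fun h3 => hb' (hμb h3)
      rw [hE] at h8Δ h9Δ
      rcases pow_nine_dvd_sq_sub_sq_or_eq_pow_mul hπ h2 hw hres ha hc' with h9D | ⟨j, ν, hj1, hj3, hDν, hν⟩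
      · -- `π⁹ ∣ D`: then `π⁸ ∣ E`, `π^{2i+2} ∣ π^{2i+1}(μb'²)`
        have h8E : π ^ 8 ∣ π ^ (2 * i + 1) * (μ * b' ^ 2) := hED h8Δ ((pow_dvd_pow π (by norm_num)).trans h9D)
        exact hE' (hcancel ((pow_dvd_pow π (by omega)).trans h8E))
      · rw [hDν] at h8Δ h9Δ
        rcases lt_or_gt_of_ne (show 2 * j ≠ 2 * i + 1 by omega) with hlt | hlt
        · -- `2j < 2i + 1`: `π^{2j+1} ∣ D − E` and `π^{2j+1} ∣ E` force `π ∣ ν`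
          have h1 : π ^ (2 * j + 1) ∣ π ^ (2 * j) * ν - π ^ (2 * i + 1) * (μ * b' ^ 2) :=
            (pow_dvd_pow π (by omega)).trans h8Δ
          have h3 : π ^ (2 * j + 1) ∣ π ^ (2 * i + 1) * (μ * b' ^ 2) :=
            Dvd.dvd.mul_right (pow_dvd_pow π (by omega)) _
          exact hν (hcancel (hDE h1 h3))
        · -- `2i + 1 < 2j`: `π^{2i+2} ∣ D − E` and `π^{2i+2} ∣ D` force `π ∣ μ b'²`
          have h1 : π ^ (2 * i + 1 + 1) ∣ π ^ (2 * j) * ν - π ^ (2 * i + 1) * (μ * b' ^ 2) :=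
            (pow_dvd_pow π (by omega)).trans h8Δ
          have h3 : π ^ (2 * i + 1 + 1) ∣ π ^ (2 * j) * ν := Dvd.dvd.mul_right (pow_dvd_pow π (by omega)) _
          exact hE' (hcancel (hED h1 h3))
    · -- `π⁴ ∣ b`: `π⁹ ∣ E`
      have hE : π * μ * b ^ 2 = π ^ 9 * (μ * b'' ^ 2) := by rw [hb'']; ring
      rw [hE] at h8Δ h9Δ
      rcases pow_nine_dvd_sq_sub_sq_or_eq_pow_mul hπ h2 hw hres ha hc' with h9D | ⟨j, ν, hj1, hj3, hDν, hν⟩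
      · exact h9Δ (dvd_sub h9D (Dvd.intro _ rfl))
      · rw [hDν] at h8Δ
        have h1 : π ^ (2 * j + 1) ∣ π ^ (2 * j) * ν - π ^ 9 * (μ * b'' ^ 2) := (pow_dvd_pow π (by omega)).trans h8Δ
        have h3 : π ^ (2 * j + 1) ∣ π ^ 9 * (μ * b'' ^ 2) := Dvd.dvd.mul_right (pow_dvd_pow π (by omega)) _
        exact hν (hcancel (hDE h1 h3))
  | succ k ih =>
    -- `π ∣ a`
    have hpa : π ∣ a := by
      have h1 : π ∣ a ^ 2 := ⟨μ * b ^ 2 + π ^ (2 * k + 1) * c' ^ 2 * ε, by linear_combination h⟩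
      exact hπ.dvd_of_dvd_pow h1
    obtain ⟨a', rfl⟩ := hpa
    -- `π ∣ b`
    have hpb : π ∣ b := by
      have h1 : π ∣ μ * b ^ 2 := by
        refine ⟨a' ^ 2 - π ^ (2 * k) * c' ^ 2 * ε, ?_⟩
        have h3 : π * (μ * b ^ 2) = π * (π * (a' ^ 2 - π ^ (2 * k) * c' ^ 2 * ε)) := by
          linear_combination (-1 : R) * h
        exact mul_left_cancel₀ hπ.ne_zero h3
      exact hμb h1
    obtain ⟨b', rfl⟩ := hpb
    refine ih (a := a') (b := b') (mul_ne_zero (pow_ne_zero _ hπ.ne_zero) (right_ne_zero_of_mul hc)) ?_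
    have h3 : π ^ 2 * (a' ^ 2 - π * μ * b' ^ 2) = π ^ 2 * ((π ^ k * c') ^ 2 * ε) := by linear_combination h
    exact mul_left_cancel₀ (pow_ne_zero 2 hπ.ne_zero) h3

end Descent

section Field

variable [IsDomain R] [WfDvdMonoid R] {π w μ ε : R} (K : Type*) [Field K] [Algebra R K] [IsFractionRing R K]

omit [WfDvdMonoid R] in
/-- Clearing denominators: `x² − m y² = ε` in the fraction field gives `a² − m b² = c²ε` in `R` with `c ≠ 0`. [folklore] -/
private theorem exists_sq_sub_mul_sq_of_field₈ {m : R} {x y : K}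
    (h : x ^ 2 - algebraMap R K m * y ^ 2 = algebraMap R K ε) :
    ∃ a b c : R, c ≠ 0 ∧ a ^ 2 - m * b ^ 2 = c ^ 2 * ε := by
  obtain ⟨a₁, d₁, hd₁, hx⟩ := IsFractionRing.div_surjective (A := R) x
  obtain ⟨a₂, d₂, hd₂, hy⟩ := IsFractionRing.div_surjective (A := R) y
  have hd₁0 : d₁ ≠ 0 := nonZeroDivisors.ne_zero hd₁
  have hd₂0 : d₂ ≠ 0 := nonZeroDivisors.ne_zero hd₂
  have hd₁K : algebraMap R K d₁ ≠ 0 := IsFractionRing.to_map_ne_zero_of_mem_nonZeroDivisors hd₁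
  have hd₂K : algebraMap R K d₂ ≠ 0 := IsFractionRing.to_map_ne_zero_of_mem_nonZeroDivisors hd₂
  refine ⟨a₁ * d₂, a₂ * d₁, d₁ * d₂, mul_ne_zero hd₁0 hd₂0, ?_⟩
  have hx' : algebraMap R K a₁ = x * algebraMap R K d₁ := by rw [← hx, div_mul_cancel₀ _ hd₁K]
  have hy' : algebraMap R K a₂ = y * algebraMap R K d₂ := by rw [← hy, div_mul_cancel₀ _ hd₂K]
  apply IsFractionRing.injective R K
  simp only [map_sub, map_mul, map_pow]
  rw [hx', hy']
  linear_combination (algebraMap R K d₁ * algebraMap R K d₂) ^ 2 * h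

/-- **Field form: a unit `ε` of `R` with `π⁸ ‖ ε − 1` is not of the form `x² − πμ·y²` with `x, y` in the fraction field `K` of `R`**
(`π` prime, `2 = π⁴w`, `π ∤ w`, `R/(π) = {0,1}`, `π ∤ μ`) — `ε` is not a norm from `K(√(πμ))` (O'Meara 63:10); the dyadic obstruction
`(ε, πμ)_𝔭 = −1` at a prime with `e(𝔭|2) = 4`, `f(𝔭|2) = 1`. [cite: Omeara1963, §63B (63:10, 63:11a) and §63A (63:1)]
[cite: NeukirchANT1999, Ch. V §3] -/
theorem not_exists_sq_sub_mul_sq_fractionRing_of_pow_eight_dvd (hπ : Prime π) (h2 : (2 : R) = π ^ 4 * w)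
    (hw : ¬ π ∣ w) (hres : ∀ t : R, π ∣ t ∨ π ∣ t - 1) (hμ : ¬ π ∣ μ) (h8 : π ^ 8 ∣ ε - 1) (h9 : ¬ π ^ 9 ∣ ε - 1) :
    ¬ ∃ x y : K, x ^ 2 - algebraMap R K (π * μ) * y ^ 2 = algebraMap R K ε := by
  rintro ⟨x, y, h⟩
  obtain ⟨a, b, c, hc, habc⟩ := exists_sq_sub_mul_sq_of_field₈ K h
  exact not_exists_sq_sub_mul_sq_of_pow_eight_dvd hπ h2 hw hres hμ h8 h9 ⟨a, b, c, hc, by linear_combination habc⟩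

end Field

/-! ## §3 At a prime IDEAL of a Dedekind domain (`e = 4`, `f = 1`), principal or not -/

section Ideal

variable [IsDedekindDomain R] (P : Ideal R) [P.IsMaximal]

/-- Transport of `a² − m b² = c²ε` (`c ≠ 0`) from `R` to `R_𝔭` (injectivity of `R → R_𝔭` for a domain). [folklore] -/
private theorem exists_sq_sub_mul_sq_localization₈ {m ε : R} (h : ∃ a b c : R, c ≠ 0 ∧ a ^ 2 - m * b ^ 2 = c ^ 2 * ε) :
    ∃ a b c : Localization.AtPrime P, c ≠ 0 ∧
      a ^ 2 - algebraMap R _ m * b ^ 2 = c ^ 2 * algebraMap R _ ε := by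
  obtain ⟨a, b, c, hc, h⟩ := h
  refine ⟨algebraMap R _ a, algebraMap R _ b, algebraMap R _ c, ?_, ?_⟩
  · exact fun h0 => hc (IsLocalization.injective (Localization.AtPrime P) P.primeCompl_le_nonZeroDivisors
      (by rw [h0, map_zero]))
  · have := congrArg (algebraMap R (Localization.AtPrime P)) h
    simpa only [map_sub, map_mul, map_pow] using this

/-- **`ε − 1 ∈ 𝔭⁸ ∖ 𝔭⁹` at a dyadic prime IDEAL with `e = 4`, `f = 1`: `ε` is not `a² − θb²` up to squares for `𝔭 ‖ θ`.**  `R` a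
Dedekind domain, `𝔭 ≠ 0` maximal with `R/𝔭 = 𝔽₂` (`∀ r, r ∈ 𝔭 ∨ r − 1 ∈ 𝔭`), `2 ∈ 𝔭⁴ ∖ 𝔭⁵`, `θ ∈ 𝔭 ∖ 𝔭²`, `ε − 1 ∈ 𝔭⁸ ∖ 𝔭⁹`: there are
no `a, b, c ∈ R`, `c ≠ 0`, with `a² − θb² = c²ε`.  (In `R_𝔭`: `2 = ϖ⁴w`, `θ = ϖμ` with `ϖ ∤ w, μ`, `ϖ⁸ ‖ ε − 1`, and
`not_exists_sq_sub_mul_sq_of_pow_eight_dvd`.)  «`(ε, θ)_𝔭 = −1` for `ε ≡ 1 + ϖ⁸ (mod ϖ⁹)`»; no principality of `𝔭` needed.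
[cite: Omeara1963, §63B (63:10) and §63A (63:1)] [cite: NeukirchANT1999, Ch. I §11 and Ch. V §3] -/
theorem not_exists_sq_sub_mul_sq_of_sub_one_mem_pow_eight (hP0 : P ≠ ⊥) (hres : ∀ r : R, r ∈ P ∨ r - 1 ∈ P)
    (h2 : (2 : R) ∈ P ^ 4) (h2' : (2 : R) ∉ P ^ 5) {θ : R} (hθ : θ ∈ P) (hθ' : θ ∉ P ^ 2) {ε : R}
    (h8 : ε - 1 ∈ P ^ 8) (h9 : ε - 1 ∉ P ^ 9) :
    ¬ ∃ a b c : R, c ≠ 0 ∧ a ^ 2 - θ * b ^ 2 = c ^ 2 * ε := by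
  intro h
  haveI : IsDiscreteValuationRing (Localization.AtPrime P) :=
    IsLocalization.AtPrime.isDiscreteValuationRing_of_dedekind_domain R hP0 _
  obtain ⟨ϖ, hϖ, hresS, hmem⟩ := exists_prime_uniformizer_localizationAtPrime P hP0 hres
  -- `2 = ϖ⁴ w`, `ϖ ∤ w`
  obtain ⟨w, hw⟩ : ϖ ^ 4 ∣ algebraMap R (Localization.AtPrime P) 2 := (hmem 2 4).mp h2
  rw [map_ofNat] at hw
  have hwndvd : ¬ ϖ ∣ w := by
    rintro ⟨w', rfl⟩
    apply h2'
    rw [hmem, map_ofNat, hw]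
    exact ⟨w', by ring⟩
  -- `θ = ϖ μ`, `ϖ ∤ μ`
  obtain ⟨μ, hμ⟩ : ϖ ^ 1 ∣ algebraMap R (Localization.AtPrime P) θ := (hmem θ 1).mp (by rwa [pow_one])
  rw [pow_one] at hμ
  have hμndvd : ¬ ϖ ∣ μ := by
    rintro ⟨μ', rfl⟩
    apply hθ'
    rw [hmem, hμ]
    exact ⟨μ', by ring⟩
  -- `ϖ⁸ ‖ ε − 1`
  have h8S : ϖ ^ 8 ∣ algebraMap R (Localization.AtPrime P) ε - 1 := by
    have := (hmem _ 8).mp h8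
    rwa [map_sub, map_one] at this
  have h9S : ¬ ϖ ^ 9 ∣ algebraMap R (Localization.AtPrime P) ε - 1 := by
    intro hd
    apply h9
    rw [hmem, map_sub, map_one]
    exact hd
  obtain ⟨a, b, c, hc, habc⟩ := exists_sq_sub_mul_sq_localization₈ P h
  rw [hμ] at habc
  exact not_exists_sq_sub_mul_sq_of_pow_eight_dvd hϖ hw hwndvd hresS hμndvd h8S h9S ⟨a, b, c, hc, habc⟩

variable (K : Type*) [Field K] [Algebra R K] [IsFractionRing R K]

/-- Clearing denominators (Dedekind domain version): `x² − m y² = ε` in a fraction field gives `a² − m b² = c²ε` in `R`, `c ≠ 0`. [folklore] -/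
private theorem exists_sq_sub_mul_sq_of_field₈' {m ε : R} {x y : K}
    (h : x ^ 2 - algebraMap R K m * y ^ 2 = algebraMap R K ε) :
    ∃ a b c : R, c ≠ 0 ∧ a ^ 2 - m * b ^ 2 = c ^ 2 * ε := by
  obtain ⟨a₁, d₁, hd₁, hx⟩ := IsFractionRing.div_surjective (A := R) x
  obtain ⟨a₂, d₂, hd₂, hy⟩ := IsFractionRing.div_surjective (A := R) y
  have hd₁0 : d₁ ≠ 0 := nonZeroDivisors.ne_zero hd₁
  have hd₂0 : d₂ ≠ 0 := nonZeroDivisors.ne_zero hd₂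
  have hd₁K : algebraMap R K d₁ ≠ 0 := IsFractionRing.to_map_ne_zero_of_mem_nonZeroDivisors hd₁
  have hd₂K : algebraMap R K d₂ ≠ 0 := IsFractionRing.to_map_ne_zero_of_mem_nonZeroDivisors hd₂
  refine ⟨a₁ * d₂, a₂ * d₁, d₁ * d₂, mul_ne_zero hd₁0 hd₂0, ?_⟩
  have hx' : algebraMap R K a₁ = x * algebraMap R K d₁ := by rw [← hx, div_mul_cancel₀ _ hd₁K]
  have hy' : algebraMap R K a₂ = y * algebraMap R K d₂ := by rw [← hy, div_mul_cancel₀ _ hd₂K]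
  apply IsFractionRing.injective R K
  simp only [map_sub, map_mul, map_pow]
  rw [hx', hy']
  linear_combination (algebraMap R K d₁ * algebraMap R K d₂) ^ 2 * h

/-- **Field form, `e = 4`, `f = 1`: `ε` with `ε − 1 ∈ 𝔭⁸ ∖ 𝔭⁹` is not `x² − θy²` (`θ ∈ 𝔭 ∖ 𝔭²`) with `x, y` in the fraction field** —
`ε ∉ N(K(√θ)ˣ)` (O'Meara 63:10); for the layer `K₂(√(2+θ))/K₂` of the cyclotomic `ℤ₂`-tower of a field `K` of odd degree in which `2` is
unramified, `K₂ = K(θ)`, `θ⁴ − 4θ² + 2 = 0`, take the element `2 + θ` at the dyadic prime of `K₂` above a degree-one prime of `K`.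
[cite: Omeara1963, §63B (63:10) and §63A (63:1)] [cite: NeukirchANT1999, Ch. V §3] -/
theorem forall_sq_sub_mul_sq_ne_of_sub_one_mem_pow_eight (hP0 : P ≠ ⊥) (hres : ∀ r : R, r ∈ P ∨ r - 1 ∈ P)
    (h2 : (2 : R) ∈ P ^ 4) (h2' : (2 : R) ∉ P ^ 5) {θ : R} (hθ : θ ∈ P) (hθ' : θ ∉ P ^ 2) {ε : R}
    (h8 : ε - 1 ∈ P ^ 8) (h9 : ε - 1 ∉ P ^ 9) (x y : K) :
    x ^ 2 - algebraMap R K θ * y ^ 2 ≠ algebraMap R K ε := fun h =>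
  not_exists_sq_sub_mul_sq_of_sub_one_mem_pow_eight P hP0 hres h2 h2' hθ hθ' h8 h9
    (exists_sq_sub_mul_sq_of_field₈' K h)

end Ideal

end Literature.NumberTheory.NumberFields

/-! ## §4 In the currency of Chevalley's formula: `E_K ∋ v ∉ N_G(Lˣ)` -/

noncomputable section

namespace Literature.NumberTheory.NumberFields.AmbiguousClass

open NumberField Literature.NumberTheory.GaloisRepresentations Literature.NumberTheory.GaloisRepresentations.Herbrand
  Literature.NumberTheory.GaloisRepresentations.MinkowskiUnit
  Literature.NumberTheory.GaloisRepresentations.CyclicNormIndex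

variable {K L : Type} [Field K] [NumberField K] [Field L] [NumberField L] [Algebra K L]

/-- ★★ **`v ≡ 1 (mod 𝔭⁸)`, `v ≢ 1 (mod 𝔭⁹)` is not a norm from `L = K(√m)` for `𝔭 ‖ m`** (`[L:K] = 2`, `s² = m ∈ 𝓞 K`, `s ∉ K`), at a
dyadic prime ideal `𝔭` of `𝓞 K` with `e = 4`, `f = 1` (`∀ r, r ∈ 𝔭 ∨ r − 1 ∈ 𝔭`; `2 ∈ 𝔭⁴ ∖ 𝔭⁵`; `m ∈ 𝔭 ∖ 𝔭²`), principal or not: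
`j(v) ∉ N_G(Lˣ)` (`(v, m)_𝔭 = −1`) — the non-norm unit of Chevalley's ambiguous class number formula / of the unit-norm-index doors.
For the layer `K₃ = K₂(√(2+θ))` over `K₂ = F(θ)`, `θ⁴ − 4θ² + 2 = 0`, of the cyclotomic `ℤ₂`-tower of a field `F` in which `2` is
unramified: `m = 2 + θ` at the dyadic prime of `K₂` above a degree-one dyadic prime of `F`. [cite: Omeara1963, §63A (63:1) and §63B (63:10)]
[cite: Lang1990, Ch. 13 §4, Lemma 4.1 (PDF p. 203)] -/
theorem unitsIncl_unitsMap_not_mem_map_norm_of_sub_one_mem_pow_eight [IsGalois K L] (hdeg : Module.finrank K L = 2)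
    {m : 𝓞 K} {s : L} (hs : s ^ 2 = algebraMap K L (m : K)) (hsK : s ∉ Set.range (algebraMap K L))
    (P : Ideal (𝓞 K)) [P.IsMaximal] (hP0 : P ≠ ⊥) (hres : ∀ r : 𝓞 K, r ∈ P ∨ r - 1 ∈ P)
    (h2 : (2 : 𝓞 K) ∈ P ^ 4) (h2' : (2 : 𝓞 K) ∉ P ^ 5) (hm : m ∈ P) (hm' : m ∉ P ^ 2) (v : (𝓞 K)ˣ)
    (h8 : (v : 𝓞 K) - 1 ∈ P ^ 8) (h9 : (v : 𝓞 K) - 1 ∉ P ^ 9) :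
    unitsIncl K L (Units.map (algebraMap (𝓞 K) K : 𝓞 K →* K) v) ∉
      (⊤ : Subgroup Lˣ).map (Herbrand.norm (L ≃ₐ[K] L)) := by
  haveI : FiniteDimensional K L := Module.Finite.of_restrictScalars_finite ℚ K L
  refine not_mem_map_norm_of_forall_sq_sub_mul_sq_ne hdeg hs hsK _ fun a b => ?_
  have h := forall_sq_sub_mul_sq_ne_of_sub_one_mem_pow_eight P K hP0 hres h2 h2' hm hm' h8 h9 a b
  simpa using h

/-! ## §5 The flexible certificate: `v·x²·(a² − m b²) ≡ 1 + π⁸ (mod π⁹)` -/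

/-- ★★ **Flexible form of the non-norm certificate: `w := v·x²·(a² − m b²)` with `w − 1 ∈ 𝔭⁸ ∖ 𝔭⁹` ⟹ `j(v) ∉ N_G(Lˣ)`** (`[L:K] = 2`, `L = K(s)`,
`s² = m`, `s ∉ K`; `𝔭` a prime of `𝓞 K` with residue field `𝔽₂`, `2 ∈ 𝔭⁴ ∖ 𝔭⁵`, `m ∈ 𝔭 ∖ 𝔭²`; `v` a unit and `x, a, b ∈ 𝓞 K` arbitrary).  For if
`v = a'² − m b'²` with `a', b' ∈ K`, Brahmagupta's identity `(a'² − m b'²)(a² − m b²) = (a'a + m b'b)² − m(a'b + b'a)²` makes `w` itself a value of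
`X² − mY²`, contradicting §3.  USE: every class of `Kˣ` modulo norms from `K_𝔭(√m)` is hit by such a `w` with `x, a, b` GLOBAL integers (weak approximation
is not even needed: `𝓞 K → 𝓞 K/𝔭⁹` is onto), so a non-norm unit `v` ALWAYS admits this certificate, whereas the normal form `v − 1 ∈ 𝔭⁸ ∖ 𝔭⁹` of §4 may
require multiplying `v` by norm-UNITS that a given field need not possess. [cite: Omeara1963, §63B (63:10, 63:11a)] [cite: Lang1990, Ch. 13 §4, Lemma 4.1 (PDF p. 203)] -/
theorem unitsIncl_unitsMap_not_mem_map_norm_of_mul_sq_mul_sub_one_mem_pow_eight [IsGalois K L] (hdeg : Module.finrank K L = 2)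
    {m : 𝓞 K} {s : L} (hs : s ^ 2 = algebraMap K L (m : K)) (hsK : s ∉ Set.range (algebraMap K L))
    (P : Ideal (𝓞 K)) [P.IsMaximal] (hP0 : P ≠ ⊥) (hres : ∀ r : 𝓞 K, r ∈ P ∨ r - 1 ∈ P)
    (h2 : (2 : 𝓞 K) ∈ P ^ 4) (h2' : (2 : 𝓞 K) ∉ P ^ 5) (hm : m ∈ P) (hm' : m ∉ P ^ 2) (v : (𝓞 K)ˣ) (x a b : 𝓞 K)
    (h8 : (v : 𝓞 K) * x ^ 2 * (a ^ 2 - m * b ^ 2) - 1 ∈ P ^ 8) (h9 : (v : 𝓞 K) * x ^ 2 * (a ^ 2 - m * b ^ 2) - 1 ∉ P ^ 9) :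
    unitsIncl K L (Units.map (algebraMap (𝓞 K) K : 𝓞 K →* K) v) ∉
      (⊤ : Subgroup Lˣ).map (Herbrand.norm (L ≃ₐ[K] L)) := by
  haveI : FiniteDimensional K L := Module.Finite.of_restrictScalars_finite ℚ K L
  refine not_mem_map_norm_of_forall_sq_sub_mul_sq_ne hdeg hs hsK _ fun a' b' heq => ?_
  -- `w = (x(a'a + m b'b))² − m (x(a'b + b'a))²` in `K`
  have hw := forall_sq_sub_mul_sq_ne_of_sub_one_mem_pow_eight P K hP0 hres h2 h2' hm hm' h8 h9
    ((x : K) * (a' * (a : K) + (m : K) * b' * (b : K))) ((x : K) * (a' * (b : K) + b' * (a : K)))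
  apply hw
  have heq' : a' ^ 2 - (m : K) * b' ^ 2 = ((v : 𝓞 K) : K) := by simpa using heq
  simp only [map_mul, map_sub, map_pow]
  change ((x : K) * (a' * (a : K) + (m : K) * b' * (b : K))) ^ 2 - (m : K) * ((x : K) * (a' * (b : K) + b' * (a : K))) ^ 2 =
    ((v : 𝓞 K) : K) * (x : K) ^ 2 * ((a : K) ^ 2 - (m : K) * (b : K) ^ 2)
  rw [← heq']
  ring

end Literature.NumberTheory.NumberFields.AmbiguousClass

end
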